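import Summits.AtomisticToContinuum.Crystallization.Theses.GappedShellCensus

/-!
# Stub `stub_tfReflexHub` — reflex void behind a hub common
# (crux `GappedShellCensus.TornFree`, line `Sketch`)

If `q₂ ≠ 0` and `q₁, q₃` make angles of cosine `≥ 1/4` with `q₂` (all three orthogonal to the
bond axis `b`), then `e = −q₂/‖q₂‖` is a unit vector orthogonal to `b` with
`⟪q i, e⟫ ≤ −‖q i‖/4` for `i = 1, 2, 3`: the three vectors lie in the sector of half-opening
`arccos (1/4) ≈ 75.5°` about `q₂`, so the opposite sector of half-opening `≈ 104.5°` is free of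
them.  Elementary inner-product algebra: with `t = ‖q₂‖⁻¹` one has `⟪q i, (−t) • q₂⟫ = −t ⟪q i, q₂⟫`
and `t ‖q₂‖ = 1`, so the cosine hypotheses rescale to the claimed bounds (`tfReflexHub_scale`).
-/

noncomputable section

namespace Summit.AtomisticToContinuum.Crystallization.Theorems

open scoped RealInnerProductSpace

/-- Rescaling a cosine lower bound: if `t n = 1`, `t ≥ 0` and `m n / 4 ≤ c`, then
`−t c ≤ −m/4`. -/
private theorem tfReflexHub_scale {t n c m : ℝ} (htn : t * n = 1) (ht : 0 ≤ t)
    (h : 1 / 4 * (m * n) ≤ c) : -t * c ≤ -(1 / 4) * m := by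
  have h' := mul_le_mul_of_nonneg_left h ht
  have e : t * (1 / 4 * (m * n)) = 1 / 4 * m * (t * n) := by ring
  rw [e, htn, mul_one] at h'
  linarith

/-- **Stub (reflex void behind a hub).** If `q₂ ≠ 0` and `q₁, q₃` make angles of cosine `≥ 1/4`
with `q₂` (all three orthogonal to `b`), then `e = −q₂/‖q₂‖` is a unit vector `⊥ b` with
`⟪q i, e⟫ ≤ −‖q i‖/4` for `i = 1, 2, 3`: the three vectors lie in the sector of half-opening
`arccos (1/4) ≈ 75.5°` about `q₂`, so the opposite sector of half-opening `104.5°` is free.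
[folklore] -/
theorem stub_tfReflexHub :
    ∀ b : EuclideanSpace ℝ (Fin 3), b ≠ 0 → ∀ q₁ q₂ q₃ : EuclideanSpace ℝ (Fin 3),
      ⟪q₁, b⟫ = 0 → ⟪q₂, b⟫ = 0 → ⟪q₃, b⟫ = 0 → q₂ ≠ 0 →
      1 / 4 * (‖q₁‖ * ‖q₂‖) ≤ ⟪q₁, q₂⟫ → 1 / 4 * (‖q₃‖ * ‖q₂‖) ≤ ⟪q₃, q₂⟫ →
      ∃ e : EuclideanSpace ℝ (Fin 3), ‖e‖ = 1 ∧ ⟪e, b⟫ = 0 ∧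
        ⟪q₁, e⟫ ≤ -(1 / 4) * ‖q₁‖ ∧ ⟪q₂, e⟫ ≤ -(1 / 4) * ‖q₂‖ ∧ ⟪q₃, e⟫ ≤ -(1 / 4) * ‖q₃‖ := by
  intro b _hb q₁ q₂ q₃ _h1 h2 _h3 hq2 h12 h32
  have hn : 0 < ‖q₂‖ := norm_pos_iff.mpr hq2
  have ht0 : 0 < ‖q₂‖⁻¹ := inv_pos.mpr hn
  have htn : ‖q₂‖⁻¹ * ‖q₂‖ = 1 := inv_mul_cancel₀ hn.ne'
  refine ⟨(-‖q₂‖⁻¹) • q₂, ?_, ?_, ?_, ?_, ?_⟩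
  · rw [norm_smul, norm_neg, Real.norm_eq_abs, abs_of_pos ht0, htn]
  · rw [real_inner_smul_left, h2, mul_zero]
  · rw [real_inner_smul_right]
    exact tfReflexHub_scale htn ht0.le h12
  · rw [real_inner_smul_right, real_inner_self_eq_norm_sq]
    have h22 : 1 / 4 * (‖q₂‖ * ‖q₂‖) ≤ ‖q₂‖ ^ 2 := by
      rw [sq]; nlinarith [mul_self_nonneg ‖q₂‖]
    exact tfReflexHub_scale htn ht0.le h22
  · rw [real_inner_smul_right]
    exact tfReflexHub_scale htn ht0.le h32

end Summit.AtomisticToContinuum.Crystallization.Theorems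

end
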